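import Summits.CriticalPhenomena.CardyFormulaZ2.Theorems.CardyComplexConeParafermionToSLESixFamiliesIicDefs
import Summits.CriticalPhenomena.CardyFormulaZ2.Theorems.CardyComplexConeSLESixFamiliesGiveCardySmoothMarkFamilies
import Summits.CriticalPhenomena.CardyFormulaZ2.Theorems.CardyBoundaryCoulombGasAssembly
import Literature.Probability.Percolation.InterfaceTraversalBoundData4
import Literature.Probability.RandomPlanarGeometry.RectangleConformalMap
import HarnessLib

/-!
# Stub S7 `stub_allDomainsOfRectilinear` of line `iic-trace-flux-pairing` (crux `ParafermionToSLESixFamilies`, stmt-CriticalPhenomena-11389): audit, non-vacuity, and the reduction to its two literature-sized pieces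

Route `CardyComplexCone` (sub-problem `CriticalPhenomena/CardyFormulaZ2`), crux
`Summit.CriticalPhenomena.CardyFormulaZ2.Theses.CardyComplexCone.ParafermionToSLESixFamilies`, line
`iic-trace-flux-pairing` (skeleton `Cruxes/ParafermionToSLESixFamilies/Lines/iic_trace_flux_pairing.lean`,
vocabulary `Theorems/CardyComplexConeParafermionToSLESixFamiliesIicDefs.lean`). Stub S7 reads

  `(∀ D, IsRectilinear D → ∀ Λ, IsFamily D Λ → SLESixAlong D Λ) → SLESixAllFamilies`

(SLE₆ along every admissible family of every RECTILINEAR Dobrushin polygon ⇒ block C of the crux: SLE₆ for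
every Jordan Dobrushin domain along every admissible family). It is the Camia–Newman transfer (PTRF 139
(2007), Thms 2–5, there for site percolation on `𝕋`) transplanted to bond-`ℤ²`, fed by Cardy's formula
obtained from the hypothesis; this file does NOT prove it. It records, sorry-free:

* §1 **the rectilinearity predicate is faithful and inhabited**: a Dobrushin domain whose frontier is the
  closed polygon through an axis-parallel vertex list is rectilinear
  (`isRectilinear_of_frontier_eq_range_polygonLoop`), every marking of an open rectangle `(-a,a) × (-b,b)`
  is rectilinear (`isRectilinear_of_carrier_eq_symRect`), `exists_isRectilinear` (registered glue);
* §2 **the hypothesis class of S7 is inhabited**: the square `(-1,1)²` marked at the midpoints of its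
  bottom and top sides is rectilinear AND carries an admissible discretisation
  family (`exists_isRectilinear_and_isFamily`), by the landed STATEMENT F `stub_smoothMarkFamilies` of
  crux `SLESixFamiliesGiveCardy` (flat side points are smooth marks) — so the antecedent of S7 is not
  vacuously true, and `IsFamily` (= `ZdDiscretisationFamily`, `isFamily_iff_zdDiscretisationFamily`) is
  satisfiable (first such family for a polygon in the tree);
* §3 **the reduction**: block C follows from IDENTIFICATION of every subsequential interface law as the
  chordal SLE₆ law on ALL Jordan domains, by Aizenman–Burchard tightness for
  arbitrary admissible families (`isTightAlongMesh_bondInterfaceIn`, landed), measurability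
  (`measurable_bondInterfaceIn`) and the tree's Prokhorov + uniqueness criterion
  (`convergesInLawToSLE_of_isTightAlongMesh'`): `slesixAllFamilies_of_identAllFamilies`; and S7 itself
  follows from two typed, UNPROVED pieces — PIECE 1 (SLE₆ on rectilinear polygons ⇒ Cardy's crossing limit
  for rectilinear conformal rectangles: crux 9654's line `collar-touch-sandwich` restricted to rectilinear
  designer domains) and PIECE 2 (Cardy for all conformal rectangles ⇒ identification on all Jordan
  domains: Camia–Newman §§5–7 / Werner Lecture 3 §§3.4–3.8 on `ℤ²`) — glued through the tree's PROVED
  `RectilinearSuffices_proof` (Cardy on rectilinear rectangles ⇒ `CardyFormulaZ2`, Bollobás–Riordan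
  sandwich): `allDomainsOfRectilinear_of`, where the two pieces are spelled out as HYPOTHESES (nothing is
  asserted; no proposition is defined in this file).
-/

noncomputable section

namespace Summit.CriticalPhenomena.CardyFormulaZ2.Cruxes.ParafermionToSLESixFamilies.IicTraceFluxPairing

open scoped Topology NNReal ENNReal
open Filter MeasureTheory Set Metric
open Literature.Probability.LatticeModels Literature.Probability.RandomPlanarGeometry
open Literature.Probability.Percolation (measurable_bondInterfaceIn isTightAlongMesh_bondInterfaceIn)
open Summit.CriticalPhenomena.CardyFormulaZ2.Cruxes.SLESixFamiliesGiveCardy.CollarTouchSandwich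
  (IsSmoothMark stub_smoothMarkFamilies)
open Summit.CriticalPhenomena.CardyFormulaZ2.Theses.CardyBoundaryCoulombGas (RectilinearCardy)

/-! ## §1 Rectilinearity of polygonal and rectangular Dobrushin domains -/

/-- Bookkeeping: a `Fin n`-indexed union of closed segments is the union over the finite set of its
endpoint pairs. -/
theorem iUnion_fin_segment_eq_biUnion {n : ℕ} (f : Fin n → ℂ × ℂ) :
    (⋃ k : Fin n, segment ℝ (f k).1 (f k).2) =
      ⋃ e ∈ (Finset.univ.image f : Finset (ℂ × ℂ)), segment ℝ e.1 e.2 := by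
  ext z
  simp only [mem_iUnion, Finset.mem_image, Finset.mem_univ, true_and, exists_prop]
  constructor
  · rintro ⟨k, hk⟩
    exact ⟨f k, ⟨k, rfl⟩, hk⟩
  · rintro ⟨e, ⟨k, rfl⟩, hk⟩
    exact ⟨k, hk⟩

/-- **Axis-parallel closed polygons bound rectilinear Dobrushin domains**: if the frontier of `D` is
the closed polygon through a nonempty vertex list whose cyclically consecutive vertices differ in one
coordinate only, then `D` is rectilinear (the finite set of sides witnesses `IsRectilinear`;
`range_polygonLoop`). Applies to every `polygonDomain` of a lattice cycle and to rectangles. -/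
theorem isRectilinear_of_frontier_eq_range_polygonLoop (D : DobrushinDomain) {l : List ℂ}
    (hl : l ≠ [])
    (hax : ∀ (k : ℕ) (hk : k < l.length),
      (l[k] - l[(k + 1) % l.length]'(Nat.mod_lt _ (by omega))).re = 0 ∨
        (l[k] - l[(k + 1) % l.length]'(Nat.mod_lt _ (by omega))).im = 0)
    (hD : frontier D.carrier = range (polygonLoop l)) : IsRectilinear D := by
  classical
  refine ⟨Finset.univ.image fun k : Fin l.length =>
      (l[(k : ℕ)], l[((k : ℕ) + 1) % l.length]'(Nat.mod_lt _ k.pos)), ?_, ?_⟩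
  · intro e he
    obtain ⟨k, -, rfl⟩ := Finset.mem_image.1 he
    exact hax k k.2
  · rw [hD, range_polygonLoop hl, ← iUnion_fin_segment_eq_biUnion]

/-- The corners of the rectangle `(-a, a) × (-b, b)`, listed counterclockwise from the bottom-left one,
differ cyclically consecutively in one coordinate only. -/
theorem rectVerts_axisParallel (a b : ℝ) :
    ∀ (k : ℕ) (hk : k < (rectVerts a b).length),
      ((rectVerts a b)[k] -
          (rectVerts a b)[(k + 1) % (rectVerts a b).length]'(Nat.mod_lt _ (by omega))).re = 0 ∨
        ((rectVerts a b)[k] -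
          (rectVerts a b)[(k + 1) % (rectVerts a b).length]'(Nat.mod_lt _ (by omega))).im = 0 := by
  intro k hk
  have hk4 : k < 4 := by simpa using hk
  interval_cases k <;> simp [rectVerts]

/-- **Every Dobrushin marking of an open axis-parallel rectangle `(-a, a) × (-b, b)` is rectilinear**
(marks anywhere on the boundary, corners allowed): its frontier is the closed polygon through the four
corners (`range_polygonLoop_rectVerts`). -/
theorem isRectilinear_of_carrier_eq_symRect (D : DobrushinDomain) {a b : ℝ} (ha : 0 < a) (hb : 0 < b)
    (hD : D.carrier = symRect a b) : IsRectilinear D :=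
  isRectilinear_of_frontier_eq_range_polygonLoop D (by simp [rectVerts]) (rectVerts_axisParallel a b)
    (by rw [hD, range_polygonLoop_rectVerts ha hb])

/-! ## §2 A rectilinear Dobrushin polygon with an admissible family: the hypothesis of S7 is inhabited

The witness is the open square `(-1, 1)²` (`rectDomain 1 1`) marked at the midpoints `-i`, `i` of its
bottom and top sides (boundary parameters `1/8`, `5/8` of the closed polygon through the corners), built
inline with the anonymous constructor (no new definition); the lemmas are stated for any Dobrushin domain
with that boundary loop / carrier / marked points. -/

/-- The mark parameters `1/8 < 5/8` of the witness square are strictly increasing. -/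
theorem squareMarks_strictMono : StrictMono (![1 / 8, 5 / 8] : Fin 2 → ℝ) := by
  refine Fin.strictMono_iff_lt_succ.2 fun k => ?_
  fin_cases k
  simp
  norm_num

/-- The mark parameters of the witness square lie in the fundamental period `[0, 1)`. -/
theorem squareMarks_mem : ∀ i : Fin 2, (![1 / 8, 5 / 8] : Fin 2 → ℝ) i ∈ Ico (0 : ℝ) 1 := by
  intro i
  fin_cases i <;> simp <;> norm_num

/-- **Registered glue `exists_isRectilinear`**: rectilinear Dobrushin polygons exist (the marked square
`(-1,1)²`), so `∀ D, IsRectilinear D → …` statements are not vacuous. -/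
theorem exists_isRectilinear : ∃ D : DobrushinDomain, IsRectilinear D :=
  ⟨⟨rectDomain 1 1 one_pos one_pos, ![1 / 8, 5 / 8], squareMarks_strictMono, squareMarks_mem⟩,
    isRectilinear_of_carrier_eq_symRect _ one_pos one_pos rfl⟩

/-- The closed polygon through the corners of `(-1,1)²` at parameter `(k + 1/2)/4` is the midpoint of
side `k`. -/
theorem polygonLoop_rectVerts_midpoint (k : ℕ) (hk : k < 4) :
    polygonLoop (rectVerts (1 : ℝ) 1) (((k : ℝ) + 1 / 2) / 4) =
      AffineMap.lineMap ((rectVerts (1 : ℝ) 1)[k]'(by simpa using hk))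
        ((rectVerts (1 : ℝ) 1)[(k + 1) % 4]'(by simp; omega)) (1 / 2 : ℝ) := by
  have h := polygonLoop_apply_div (l := rectVerts (1 : ℝ) 1) (k := k) (by simpa using hk)
    (θ := 1 / 2) ⟨by norm_num, by norm_num⟩
  simpa using h

/-- A Dobrushin domain bounded by the corner polygon of `(-1,1)²` with first mark parameter `1/8` has first
marked point the bottom midpoint `-i`. -/
theorem pt_zero_of_square (D : DobrushinDomain) (hb : D.boundary = polygonLoop (rectVerts (1 : ℝ) 1))
    (hm : D.mark 0 = 1 / 8) : D.pt 0 = ⟨0, -1⟩ := by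
  change D.boundary (D.mark 0) = _
  have e : (1 / 8 : ℝ) = (((0 : ℕ) : ℝ) + 1 / 2) / 4 := by norm_num
  rw [hb, hm, e, polygonLoop_rectVerts_midpoint 0 (by norm_num)]
  apply Complex.ext <;> norm_num [rectVerts, AffineMap.lineMap_apply_module']

/-- A Dobrushin domain bounded by the corner polygon of `(-1,1)²` with second mark parameter `5/8` has
second marked point the top midpoint `i`. -/
theorem pt_one_of_square (D : DobrushinDomain) (hb : D.boundary = polygonLoop (rectVerts (1 : ℝ) 1))
    (hm : D.mark 1 = 5 / 8) : D.pt 1 = ⟨0, 1⟩ := by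
  change D.boundary (D.mark 1) = _
  have e : (5 / 8 : ℝ) = (((2 : ℕ) : ℝ) + 1 / 2) / 4 := by norm_num
  rw [hb, hm, e, polygonLoop_rectVerts_midpoint 2 (by norm_num)]
  apply Complex.ext <;> norm_num [rectVerts, AffineMap.lineMap_apply_module']

/-- The bottom midpoint of the square is a smooth mark: after no rotation (`e = 1`) the square is, within
distance `1`, the strict epigraph `{im w > 0}` of the zero function. -/
theorem isSmoothMark_zero_of_square (D : DobrushinDomain) (hD : D.carrier = symRect 1 1)
    (h0 : D.pt 0 = ⟨0, -1⟩) : IsSmoothMark D 0 := by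
  refine ⟨1, fun _ => 0, 1, Or.inl rfl, one_pos, contDiffOn_const, rfl,
    Or.inr ⟨0, Or.inl rfl, fun t => by simp⟩, fun w hw => ?_⟩
  have hre := (abs_lt.1 ((Complex.abs_re_le_norm w).trans_lt hw))
  have him := (abs_lt.1 ((Complex.abs_im_le_norm w).trans_lt hw))
  rw [h0, one_mul, hD, mem_symRect]
  simp only [Complex.add_re, Complex.add_im]
  constructor
  · rintro ⟨-, h1, -⟩; linarith
  · intro h; exact ⟨⟨by linarith, by linarith⟩, by linarith, by linarith⟩

/-- The top midpoint of the square is a smooth mark: after the half-turn `e = -1` the square is, within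
distance `1`, the strict epigraph `{im w > 0}` of the zero function. -/
theorem isSmoothMark_one_of_square (D : DobrushinDomain) (hD : D.carrier = symRect 1 1)
    (h1 : D.pt 1 = ⟨0, 1⟩) : IsSmoothMark D 1 := by
  refine ⟨-1, fun _ => 0, 1, Or.inr (Or.inr (Or.inl rfl)), one_pos, contDiffOn_const, rfl,
    Or.inr ⟨0, Or.inl rfl, fun t => by simp⟩, fun w hw => ?_⟩
  have hre := (abs_lt.1 ((Complex.abs_re_le_norm w).trans_lt hw))
  have him := (abs_lt.1 ((Complex.abs_im_le_norm w).trans_lt hw))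
  rw [h1, neg_one_mul, hD, mem_symRect]
  simp only [Complex.add_re, Complex.add_im, Complex.neg_re, Complex.neg_im]
  constructor
  · rintro ⟨-, -, h1⟩; linarith
  · intro h; exact ⟨⟨by linarith, by linarith⟩, by linarith, by linarith⟩

/-- The six family fields of the crux are exactly the tree's `ZdDiscretisationFamily` (same fields,
same types). -/
theorem isFamily_iff_zdDiscretisationFamily {D : DobrushinDomain} {Λ : ℝ → DiscreteDobrushin} :
    IsFamily D Λ ↔ ZdDiscretisationFamily D Λ :=
  ⟨fun h => ⟨h.1, h.2.1, h.2.2.1, h.2.2.2.1, h.2.2.2.2.1, h.2.2.2.2.2⟩,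
    fun h => ⟨h.Ω_eq, h.δ_eq, h.tendsto_arcA, h.tendsto_arcB, h.tendsto_zdABEdges,
      h.eventually_isZdAdmissible⟩⟩

/-- A Dobrushin domain with carrier `(-1,1)²` marked at `-i` and `i` carries an admissible discretisation
family (STATEMENT F `stub_smoothMarkFamilies` of crux 9654 at its two flat marks). -/
theorem exists_isFamily_of_square (D : DobrushinDomain) (hD : D.carrier = symRect 1 1)
    (h0 : D.pt 0 = ⟨0, -1⟩) (h1 : D.pt 1 = ⟨0, 1⟩) : ∃ Λ : ℝ → DiscreteDobrushin, IsFamily D Λ := by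
  obtain ⟨Λ, hΛ⟩ := stub_smoothMarkFamilies D (isSmoothMark_zero_of_square D hD h0)
    (isSmoothMark_one_of_square D hD h1)
  exact ⟨Λ, isFamily_iff_zdDiscretisationFamily.2 hΛ⟩

/-- **The hypothesis class of S7 is inhabited** (registered glue): there is a rectilinear Dobrushin polygon
together with an admissible discretisation family of it — the square `(-1,1)²` marked at `∓i`. Hence the
antecedent `∀ D, IsRectilinear D → ∀ Λ, IsFamily D Λ → SLESixAlong D Λ` of S7 is a genuine instance of the
SLE₆ conjecture on `ℤ²` (not vacuously true), and S7 is not block C in disguise. -/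
theorem exists_isRectilinear_and_isFamily :
    ∃ (D : DobrushinDomain) (Λ : ℝ → DiscreteDobrushin), IsRectilinear D ∧ IsFamily D Λ := by
  obtain ⟨Λ, hΛ⟩ := exists_isFamily_of_square
    ⟨rectDomain 1 1 one_pos one_pos, ![1 / 8, 5 / 8], squareMarks_strictMono, squareMarks_mem⟩ rfl
    (pt_zero_of_square _ rfl (by simp)) (pt_one_of_square _ rfl (by simp))
  exact ⟨_, Λ, isRectilinear_of_carrier_eq_symRect _ one_pos one_pos rfl, hΛ⟩

/-! ## §3 The reduction of S7 to identification on all domains, and its two missing pieces (typed as hypotheses)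

Nothing in this section is asserted: the two literature-sized pieces appear only as HYPOTHESES of the
composition `allDomainsOfRectilinear_of`, spelled out in full. -/

/-- The interface functional is measurable at every mesh (it factors through the finitely-valued medial
exploration; `measurable_bondInterfaceIn`, no admissibility needed), hence eventually a.e.-measurable. -/
theorem aemeasurable_iface_all (D : DobrushinDomain) (Λ : ℝ → DiscreteDobrushin) :
    ∀ᶠ δ in 𝓝[>] (0 : ℝ), AEMeasurable (iface D Λ δ) (perc δ) :=
  Eventually.of_forall fun δ => (measurable_bondInterfaceIn D (Λ δ)).aemeasurable

/-- **One family: identification ⇒ SLE₆ convergence.** Along an admissible family of any Dobrushin domain,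
if every subsequential limit law of the interface is the SLE₆ law then the interface converges in law to
SLE₆: Aizenman–Burchard tightness for arbitrary admissible data (`isTightAlongMesh_bondInterfaceIn`,
`InterfaceTraversalBoundData4.lean`; `iface D Λ δ` is `bondInterfaceIn D (Λ δ)` definitionally),
measurability, and the tree's criterion `convergesInLawToSLE_of_isTightAlongMesh'` (Prokhorov +
uniqueness in law of SLE₆). -/
theorem slesixAlong_of_ident (D : DobrushinDomain) (Λ : ℝ → DiscreteDobrushin) (hΛ : IsFamily D Λ)
    (hI : ∀ μ : Measure (CurveClass ℂ), IsProbabilityMeasure μ → IsSubseqLimitLaw (iface D Λ) perc μ →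
      IsSLELaw 6 D μ) :
    SLESixAlong D Λ :=
  convergesInLawToSLE_of_isTightAlongMesh' (aemeasurable_iface_all D Λ)
    (isTightAlongMesh_bondInterfaceIn D Λ hΛ.1 hΛ.2.1 hΛ.2.2.2.2.2) hI

/-- **Block C from IDENTIFICATION ON ALL JORDAN DOMAINS** (registered glue): if along every admissible
family of every Dobrushin domain every probability measure that is a subsequential weak limit of the
interface laws is the chordal SLE₆ law of `(D; a, b)` (the all-domains twin of the line's
`IdentOnRectilinear`; the output of the Camia–Newman scheme), then block C holds. This is the exact
residue of S7 once tightness (landed) is discounted: S7's hypothesis can only enter through the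
identification step, i.e. through Cardy's formula. -/
theorem slesixAllFamilies_of_identAllFamilies :
    (∀ (D : DobrushinDomain) (Λ : ℝ → DiscreteDobrushin), IsFamily D Λ → ∀ μ : Measure (CurveClass ℂ), IsProbabilityMeasure μ → IsSubseqLimitLaw (iface D Λ) perc μ → IsSLELaw 6 D μ) → SLESixAllFamilies := by
  intro hI
  exact slesixAllFamilies_iff.2 fun D Λ hΛ => slesixAlong_of_ident D Λ hΛ (hI D Λ hΛ)

/-- **S7 from its two missing pieces** (registered glue; kernel-checked composition). Hypotheses, both
UNPROVED and of literature size: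

* PIECE 1 — SLE₆ along every admissible family of every rectilinear Dobrushin polygon ⇒ Cardy's crossing
  limit for every rectilinear conformal rectangle (`RectilinearCardy` of route `CardyBoundaryCoulombGas`,
  covering form of rectilinearity). Content: crux 9654's line `collar-touch-sandwich` (stubs B `LowerRun`,
  C `TouchLimsup`, D `SleSideTouch`, E `CollarDomains`, F `SmoothMarkFamilies`, G `ModulusContinuity`
  landed; A `UpperFence` open) run at RECTILINEAR designer domains, which needs its collar construction E
  with rectilinear outputs for rectilinear input (rectangular collars behind flat sub-arcs; plateau marks
  are smooth marks, §2), and the passage from the covering form `frontier ⊆ ⋃ segments` to `IsRectilinear`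
  (a Jordan curve inside finitely many axis-parallel segments is a finite union of such segments) — or,
  cheaper, a re-export of `exists_rectilinear_close` with `=` and a re-run of the sandwich below.
* PIECE 2 — the Camia–Newman transfer on `ℤ²`: Cardy's formula for bond percolation in every conformal
  rectangle ⇒ identification of every subsequential interface law as chordal SLE₆, for every Jordan
  Dobrushin domain and every admissible family (Camia–Newman 2007 Thms 2–4, §§5–7; Werner 2007 Lecture 3
  §§3.4–3.8: Loewner description of subsequential limits, Cardy–Smirnov crossing martingales in the slit
  domains along the exploration, `κ = 6` by Lévy). On `ℤ²` the tree has RSW (`rsw_half_holds`), the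
  half-plane three-arm window bound (`Z2HalfPlane.real_threeArm_le`), tightness (above) and the martingale
  identification of SLE_κ (`isSLELaw_of_isLocalMartingale_driving`, `levy_characterisation_holds`,
  `hasSLETrace_of_ne_eight_holds`); it does NOT have Cardy uniformly for the slit sub-domains generated
  along the exploration (CN Thm 3 / Werner §§3.6–3.7) nor the no-close-encounter lemmas (CN Lemmas
  6.1–6.4, 7.1–7.4) for bond-`ℤ²`.

Glue: PIECE 1 ⇒ (`RectilinearSuffices_proof`, PROVED in the tree: Bollobás–Riordan sandwich with
rectilinear lattice-polygon approximants and Radó continuity of the modulus) `CardyFormulaZ2` ⇒ PIECE 2 ⇒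
(`slesixAllFamilies_of_identAllFamilies`) block C. -/
theorem allDomainsOfRectilinear_of :
    ((∀ D : DobrushinDomain, IsRectilinear D → ∀ Λ : ℝ → DiscreteDobrushin, IsFamily D Λ → SLESixAlong D Λ) → RectilinearCardy) → (CardyFormulaZ2 → ∀ (D : DobrushinDomain) (Λ : ℝ → DiscreteDobrushin), IsFamily D Λ → ∀ μ : Measure (CurveClass ℂ), IsProbabilityMeasure μ → IsSubseqLimitLaw (iface D Λ) perc μ → IsSLELaw 6 D μ) → (∀ D : DobrushinDomain, IsRectilinear D → ∀ Λ : ℝ → DiscreteDobrushin, IsFamily D Λ → SLESixAlong D Λ) → SLESixAllFamilies := by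
  intro h₁ h₂ h
  exact slesixAllFamilies_of_identAllFamilies
    (h₂ (Summit.CriticalPhenomena.CardyFormulaZ2.Theorems.RectilinearSuffices_proof (h₁ h)))

end Summit.CriticalPhenomena.CardyFormulaZ2.Cruxes.ParafermionToSLESixFamilies.IicTraceFluxPairing

end
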